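import Literature.Topology.FourManifolds.FramedTubularNbhd
import Literature.Topology.FourManifolds.KnotsProofs
import HarnessLib

/-!
# The equatorial spheres, and the unknotted 2-sphere, are normally framed

Companion to `FramedTubularNbhd.lean` (topic `Literature/Topology/FourManifolds`, item
`provefact-Literature.exists_isGluckTwist`). Everything here is proved.

* `Literature.isNormalFraming_sphereInclusion k m`: the standard equatorial inclusion
  `sphereInclusion k (k + m) : 𝕊ᵏ → 𝕊ᵏ⁺ᵐ`, `x ↦ (x, 0)`, carries the **constant normal framing**
  `Literature.padFrame k m` by the coordinate vector fields `e_{k+1}, …, e_{k+m}` of `ℝᵏ⁺ᵐ⁺¹`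
  (`Literature.Topology.FourManifolds.IsNormalFraming`: tangent to `𝕊ᵏ⁺ᵐ` along the equator, whose points have vanishing
  padded coordinates, and independent modulo the tangent spaces of the equator, which lie in
  `ℝᵏ⁺¹ × 0`); auxiliary `Literature.Topology.FourManifolds.euclideanInclusionCLM` (the zero-padding map of `LocallyFlat.lean`
  as a continuous linear map), `Literature.Topology.FourManifolds.ambientDeriv_sphereInclusion` (the ambient differential of
  the inclusion is the padding map after the differential of `𝕊ᵏ ⊆ ℝᵏ⁺¹`), `Literature.Topology.FourManifolds.padIndex`,
  `Literature.Topology.FourManifolds.orthonormal_padFrame`. (Smoothness and injectivity of the differential of the inclusions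
  are not restated: they follow from `isSmoothEmbedding_sphereInclusion_holds`, `KnotsProofs.lean`.)
* `Literature.Topology.FourManifolds.isNormalFraming_unknotTwo`: the unknotted 2-sphere `unknotTwo : S² ↪ S⁴` (the equatorial
  inclusion, `GluckTwist.lean`; unconditional thanks to the instance
  `SphereEmbedding.smoothnessFacts` of `KnotsProofs.lean`) is normally framed by `e₃, e₄` — the
  instance `K = unknotTwo` of the hypothesis of the named fact `TwoKnot.nonempty_normalFraming`
  (triviality of the normal bundle, Kirby (1989), Ch. VIII, Thm. 2). Its consequences via `FramedTubularNbhd.lean` /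
  `GluckTwistExistenceFramed.lean` (a tubular neighbourhood of `unknotTwo`, existence of its Gluck
  twist) are *not* restated: the tree already holds them in stronger, explicit form in
  `GluckTwistUnknotProofs.lean` (`GluckUnknot.unknotTube : TwoKnot.TubularNbhd unknotTwo` and
  `isGluckTwist_sphere_unknotTwo_holds : IsGluckTwist (𝓡 4) (𝕊 4) unknotTwo`, Gluck 1962, §17).

## References

* M. W. Hirsch, *Differential Topology*, GTM 33 (1976), Ch. 4, §5 (tubular neighbourhoods; fields
  of transverse planes). [HirschDT1976]
* R. C. Kirby, *The Topology of 4-Manifolds*, LNM 1374 (1989), Ch. VIII, Thm. 2. [Kirby1989]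
-/

open scoped Manifold ContDiff Topology RealInnerProductSpace
open Set Function Metric

noncomputable section

namespace Literature.Topology.FourManifolds

section SphereInclusion

/-- Local notation: `𝔼 n` is the model Euclidean space `EuclideanSpace ℝ (Fin n)`. -/
local notation "𝔼 " n:arg => EuclideanSpace ℝ (Fin n)

/-- Local notation: `𝕊 n` is the unit sphere in `EuclideanSpace ℝ (Fin (n + 1))`. -/
local notation "𝕊 " n:arg => (Metric.sphere (0 : EuclideanSpace ℝ (Fin (n + 1))) 1)

/-- The zero-padding inclusion `ℝᵏ → ℝⁿ` (`Literature.Topology.FourManifolds.euclideanInclusion`) as a continuous linear map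
(the additivity/homogeneity computations are the same as in `KnotsProofs.lean`'s
`exists_linearIsometry_coe_eq_euclideanInclusion`, which gives a linear *isometry* for `k ≤ n`;
here no hypothesis is needed and the map is bundled). [folklore] -/
def euclideanInclusionCLM (k n : ℕ) : 𝔼 k →L[ℝ] 𝔼 n where
  toFun := euclideanInclusion k n
  map_add' x y := by
    ext i
    simp only [euclideanInclusion_apply, PiLp.add_apply]
    split_ifs <;> simp
  map_smul' c x := by
    ext i
    simp only [euclideanInclusion_apply, PiLp.smul_apply, RingHom.id_apply, smul_eq_mul]
    split_ifs <;> simp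
  cont := continuous_euclideanInclusion k n

/-- `euclideanInclusionCLM` is `euclideanInclusion` as a function. [folklore] -/
@[simp]
theorem euclideanInclusionCLM_apply (k n : ℕ) (x : 𝔼 k) :
    euclideanInclusionCLM k n x = euclideanInclusion k n x := rfl

/-- The padded coordinates of `euclideanInclusion k n x` vanish. [folklore] -/
theorem euclideanInclusion_apply_of_le {k n : ℕ} (x : 𝔼 k) {i : Fin n} (hi : k ≤ (i : ℕ)) :
    euclideanInclusion k n x i = 0 := by
  rw [euclideanInclusion_apply, dif_neg (not_lt.2 hi)]

/-- The ambient differential of the standard inclusion of spheres is the padding map composed with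
the differential of the inclusion `𝕊ᵏ ⊆ ℝᵏ⁺¹`. [folklore] -/
theorem ambientDeriv_sphereInclusion {k n : ℕ} (h : k ≤ n) (x : 𝕊 k) :
    ambientDeriv (𝓡 k) (sphereInclusion k n h) x =
      (euclideanInclusionCLM (k + 1) (n + 1)).comp
        (mfderiv (𝓡 k) 𝓘(ℝ, 𝔼 (k + 1)) (Subtype.val : 𝕊 k → 𝔼 (k + 1)) x) := by
  haveI := Fact.mk (@finrank_euclideanSpace_fin ℝ _ (k + 1))
  have hcoe : MDifferentiableAt (𝓡 k) 𝓘(ℝ, 𝔼 (k + 1)) (Subtype.val : 𝕊 k → 𝔼 (k + 1)) x :=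
    (contMDiff_coe_sphere (m := 1)).contMDiffAt.mdifferentiableAt one_ne_zero
  have hfun : (fun y : 𝕊 k => (sphereInclusion k n h y : 𝔼 (n + 1))) =
      euclideanInclusionCLM (k + 1) (n + 1) ∘ (Subtype.val : 𝕊 k → 𝔼 (k + 1)) := rfl
  rw [ambientDeriv, hfun,
    mfderiv_comp x (euclideanInclusionCLM (k + 1) (n + 1)).hasMFDerivAt.mdifferentiableAt hcoe,
    ContinuousLinearMap.mfderiv_eq]
  rfl

/-- The padded coordinates of the ambient differential of the standard inclusion vanish.
[folklore] -/
theorem ambientDeriv_sphereInclusion_apply_of_le {k n : ℕ} (h : k ≤ n) (x : 𝕊 k) (v : 𝔼 k)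
    {i : Fin (n + 1)} (hi : k + 1 ≤ (i : ℕ)) :
    ambientDeriv (𝓡 k) (sphereInclusion k n h) x v i = 0 := by
  rw [ambientDeriv_sphereInclusion]
  exact euclideanInclusion_apply_of_le _ hi

/-- The index of the `j`-th padded coordinate of `ℝᵏ⁺¹ ⊆ ℝᵏ⁺ᵐ⁺¹`. [folklore] -/
def padIndex (k m : ℕ) (j : Fin m) : Fin (k + m + 1) :=
  ⟨k + 1 + j, by omega⟩

/-- `padIndex` is injective. [folklore] -/
theorem padIndex_injective (k m : ℕ) : Injective (padIndex k m) := by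
  intro i j hij
  have := congrArg Fin.val hij
  simp only [padIndex] at this
  exact Fin.ext (by omega)

/-- The **constant normal framing** of the standard `𝕊ᵏ ⊆ 𝕊ᵏ⁺ᵐ`: the coordinate vectors
`e_{k+1}, …, e_{k+m}` of `ℝᵏ⁺ᵐ⁺¹`. [folklore] -/
def padFrame (k m : ℕ) (j : Fin m) (_ : 𝕊 k) : 𝔼 (k + m + 1) :=
  EuclideanSpace.single (padIndex k m j) 1

/-- The constant framing is orthonormal. [folklore] -/
theorem orthonormal_padFrame (k m : ℕ) (x : 𝕊 k) : Orthonormal ℝ fun j => padFrame k m j x :=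
  (EuclideanSpace.orthonormal_single (𝕜 := ℝ) (ι := Fin (k + m + 1))).comp _
    (padIndex_injective k m)

/-- **The standard inclusion of spheres is normally framed** by the constant coordinate vector
fields `e_{k+1}, …, e_{k+m}` (tangent to `𝕊ᵏ⁺ᵐ` along the equatorial `𝕊ᵏ`, whose points have
vanishing padded coordinates, and independent modulo its tangent spaces, which lie in
`ℝᵏ⁺¹ × 0`). [folklore] -/
theorem isNormalFraming_sphereInclusion (k m : ℕ) :
    IsNormalFraming (𝓡 k) (sphereInclusion k (k + m) (Nat.le_add_right k m)) (padFrame k m) := by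
  refine ⟨fun i => contMDiff_const, fun i x => ?_, fun x v a hva => ?_⟩
  · rw [padFrame, EuclideanSpace.inner_single_left, coe_sphereInclusion,
      euclideanInclusion_apply_of_le _ (Nat.le_add_right _ _)]
    simp
  · funext i
    have h0 : ⟪padFrame k m i x, ambientDeriv (𝓡 k) (sphereInclusion k (k + m)
        (Nat.le_add_right k m)) x v⟫ = 0 := by
      rw [padFrame, EuclideanSpace.inner_single_left,
        ambientDeriv_sphereInclusion_apply_of_le _ x v (Nat.le_add_right _ _)]
      simp
    have := congrArg (fun w => ⟪padFrame k m i x, w⟫) hva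
    simpa only [inner_add_right, inner_zero_right, h0, zero_add,
      (orthonormal_padFrame k m x).inner_right_fintype, Pi.zero_apply] using this

end SphereInclusion

/-! ### The unknotted 2-sphere -/

section Unknot

/-- **The unknotted 2-sphere is normally framed** by the constant vector fields `e₃, e₄` of `ℝ⁵`
(`padFrame 2 2`): the case `k = m = 2` of `isNormalFraming_sphereInclusion`, as
`⇑unknotTwo = sphereInclusion 2 4 _` definitionally. [folklore] -/
theorem isNormalFraming_unknotTwo : IsNormalFraming (𝓡 2) (⇑unknotTwo) (padFrame 2 2) :=
  isNormalFraming_sphereInclusion 2 2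

end Unknot

end Literature.Topology.FourManifolds
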